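import Literature.MathematicalPhysics.QuantumFieldTheory.BalabanImbrieJaffe1984to88.BIJ88Eq531TranslLaw
import Literature.MathematicalPhysics.QuantumFieldTheory.BalabanImbrieJaffe1984to88.BIJ88RT51Invariant

/-!
# `BalabanImbrieJaffe1984to88.BIJ88Eq531TranslDensity` — T. Bałaban, J. Imbrie, A. Jaffe, *Effective action and cluster properties of the
abelian Higgs model*, Commun. Math. Phys. **114** (1988) 257–315 [BalabanImbrieJaffe1988], (3.24) p. 269, (5.3.1)/(5.3.6) p. 280 applied to
(3.11) p. 266 and (5.1.1) p. 277: **THE DENSITY OF THE RENORMALIZATION TRANSFORMATION AFTER THE FIRST GAUGE-FIELD TRANSLATION**, on the torus of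
record and without cut-off.  The densities `ρ₁^L` of (3.11) and `ρ̃^L_{k+1}` of (5.1.1) were CONSTRUCTED in this seat's gens 2–6 as complex
Radon–Nikodym densities of push-forwards along `(u, ψ) ↦ (Qu, ψ)` — the measure-level reading of `∫ν(du) δ(v/Qu) (…)`.  Here it is PROVED that
after the translation `u = u′·(Q^{s*}v)` of (3.24)/(5.3.1) these densities are ORDINARY FIBRE INTEGRALS: `dv dψ`-almost everywhere
`ρ̃^L_{k+1}(v, ψ) = Σ_t ∫ν(du) G_t(u′(u)·Q^{s*}v, ψ)` (`G_t` the smeared term densities), and for the printed kernel `Q(u)φ` of [2] (2.6), which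
does not see the substituted block field (`Q(u′·Q^{s*}v)φ = Q(u′)φ`), `ρ₁^L(v, ψ) = ∫ν(du) ∫𝒟φ ρ₀(u′·Q^{s*}v, φ) exp[−½aL⁻²⟨ψ − Q(u′)φ, ψ − Q(u′)φ⟩
− E]` — *"it removes the v-field from the δ-functions"* (p. 280): `v` now enters only through the translated argument of `ρ₀`.

statement-level skeleton of published theorems with citation tags; proofs where landed; nothing here is a claim about the Yang–Mills mass gap

PDF held: `paper:balaban1988-cmp114-bij-abelian-higgs-effective-action` (journal page = PDF page + 256); p. 269 [PDF 13] (this seat's render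
`renders/original-p013-x2.png`), p. 280 [PDF 24] (r16's render `HOME/lit-balaban-r16/renders/cmp114/original-p024-x2.png`), pp. 266 and 277 as
quoted verbatim in r18's `BIJ88RenormTransf311` ((3.11)) and r16's `BIJ88Sect5Statements`/this seat's `BIJ88RT51GeneralStep` ((5.1.1)).

CITATION HEADER (lean-in-tree rule).  Part of the lit-balaban TYPED SKELETON (HOME `run/shared/lean/pub/lit-balaban/`), PHASE-2 proof seat p34
gen 7 (unit `lit-balaban-p34-g7`; TAKING line HOME/STATUS.md 2026-08-21T11:21:25Z, free-target protocol G.5-34(d), own lineage = the C1/C2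
renormalization-transformation line: `BIJ85RT33`/`BIJ85RT37Normalization`/`BIJ88RT311Exists` (gen 2), `BIJ88RT51GeneralStep`/`NoChange`/
`BlockGauge`/`Unique` (gen 5), `BIJ88RT51Density`/`Exists`/`Invariant` (gen 6), `BIJ88RT51Background`(`42`) and `BIJ88Eq531TranslLaw` (gen 7)).
Rows served (support): `C2.Eq3.24`, `C2.Eq3.11` of `HOME/lit-balaban-r18/ROWS-C2.md` (owner r18), `C2.Eq5.3.1-5.3.7`, `C2.Eq5.1.1-5.1.4` of
`HOME/lit-balaban-r16/ROWS-C2-part2.md` (owner r16).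

THE PRINTED TEXT (verbatim).  p. 269 [PDF 13]: *"We begin with a translation of the gauge field which takes the block field v out of the
δ-functions of the renormalization transformation. Thus we put u_b = … ≡ u′_b(Λ₁^{(0)*}Q^{s*}v)_b, (3.24)"*.  p. 280 [PDF 24]: *"The first
translation is done in Λ₁^{(k)*}, and it removes the v-field from the δ-functions there. As in (3.24) we put u = u′(Λ₁^{(k)*}Q^{s*}v), (5.3.1) cf.
also (I.6.2). (The reader may wish to refer to chapter 6 of [2], where the effects of the translations are followed without the complications of
the large field regions.) … The translation affects the δ-functions as follows. δ_{Ax}(u) = δ_{Ax}(u′), δ(v/Qu) = δ_{Λ₁^{(k)′*c}}(v/Qu)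
δ_{Λ₁^{(k)′*}}((e_k/2π)QA′), (5.3.6)"*.  The transformed objects: (3.11) p. 266 *"ρ₁^L(v, ψ) = ∫ δ_{Ax}(u) δ(v/Qu) 𝒟u ∫𝒟φ exp[−½aL⁻²⟨ψ − Q(u)φ,
ψ − Q(u)φ⟩ − E^{(0)}] ρ₀(u, φ)"* (r18's typed `IsRT311`; this seat's constructed solution `RTData.rt`, r18's hypothesis-free datum `torusRTData`)
and (5.1.1) p. 277 (this seat's typed `IsRT511`/`IsRT511Ax` and constructed solution `rt51 ν {X_ω} Qu Q(u_k)φ a ρ′`).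

THE READING (all carriers of record; nothing re-declared; as in `BIJ88Eq531TranslLaw`).  `ν` = the law of the unit-lattice field in the
`u`-integral: `𝒟u` (`fieldMeasure`) for the printed (5.1.1), `𝒟u δ_{Ax}(u)` (r18's `axialMeasure`) for (3.11) and for (5.1.1) with (5.1.4)
inserted — both invariant under the substitutions `u ↦ u·Q^{s*}w` (r18's `map_surfMul_fieldMeasure`, gen 7's `axialMeasure_map_surfMul`), which
is the only property used; `u′ = uPrime u`, `u·Q^{s*}w = surfMul u w` (r18); `rnC ν Qu G` = gen 6's complex Radon–Nikodym density of
`(Qu × id)_*(G·(ν ⊗ dψ))` w.r.t. `dv dψ`; `smear51` = gen 6's smeared term density `G_t(u, ψ) = ∫Π𝒟u^{(j)}∫𝒟φ ρ′_t e^{−½aL⁻²‖ψ − Q_tφ‖² − E}`;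
`gaussWeight a c ψ` = r18's normalized Gaussian of (3.11)/(3.12) = [2] (3.6).  WITHOUT CUT-OFF as in the companion file (whole torus = the
[2]-chapter-6 setting).

WHAT IS PROVED (kernel-checked; theorems only, no `def`, no `Prop`-valued fact; standard axioms).
* §1 **THE RADON–NIKODYM DENSITY AFTER THE TRANSLATION** — `rnC_ae_eq_transl`: for a substitution-invariant probability law `ν` and a `ν ⊗ dψ`-
  integrable `G`, `rnC ν Q G =ᵐ[dv dψ] (v, ψ) ↦ ∫ν(du) G(u′(u)·Q^{s*}v, ψ)` (both sides integrate every bounded measurable test function to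
  `∫ν∫dψ G(u, ψ) g(Qu, ψ)`: gen 6's `integral_rnC_mul` on the left, the measure-preserving translation `((v, ψ), u) ↦ (u′(u)·Q^{s*}v, ψ)`
  (`measurePreserving_transl₃`, from gen 7's `measurePreserving_transl`) with `Q(u′·Q^{s*}v) = v` on the right; uniqueness gen 5's
  `ae_eq_of_forall_test`).
* §2 **THE (5.1.1) DENSITY AFTER THE TRANSLATION** — `rt51_ae_eq_transl`: `ρ̃^L_{k+1} = rt51 ν {X_ω} Q Q_t a ρ′ =ᵐ (v, ψ) ↦ Σ_t ∫ν(du)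
  G_t(u′(u)·Q^{s*}v, ψ)` (any finite family of terms with measurable kernels `Q_t` and integrable `ρ′_t`); for the PRINTED scalar kernel of the
  first step / of [2], `Q(u)φ = qCov u φ`, which does not see the substitution (r18's `qCov_surfMul`: the block average (2.6) transports along
  contours inside blocks), `smear51_qCov_transl` and **`rt51_printed_ae_eq_transl`**: `=ᵐ (v, ψ) ↦ ∫ν(du) ∫𝒟φ ρ₀(u′·Q^{s*}v, φ)·gaussWeight a
  (Q(u′)φ) ψ` — the `ψ`-Gaussian no longer involves `v`; instances `ν = 𝒟u δ_{Ax}(u)` (`rt51_printed_axialMeasure_ae_eq_transl`) and `ν = 𝒟u`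
  (`rt51_printed_fieldMeasure_ae_eq_transl`).
* §3 **THE PRINTED (3.11) DENSITY OF THE MODEL AFTER THE TRANSLATION** — `integrable_axialMeasure_of_jointInvariant` (a jointly gauge-invariant
  `𝒟u𝒟φ`-integrable density is `𝒟u δ_{Ax}𝒟φ`-integrable: gen 2's (3.7) mechanism `BIJ85RT37Normalization.integrable_comp_ax` + gen 2's
  `axialMeasure_eq_map_ax`) and **`rt_torusRTData_ae_eq_transl`**: for every jointly measurable, jointly gauge-invariant, `𝒟u𝒟φ`-integrable `ρ₀`
  (`a > 0`, `d ≥ 2`, standing range) r18's hypothesis-free density `ρ₁^L = (torusRTData).rt (gaussApprox) ρ₀` of (3.11) equals `dv dψ`-a.e.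
  `(v, ψ) ↦ ∫𝒟u δ_{Ax}(u) ∫𝒟φ ρ₀(u′·Q^{s*}v, φ) exp[−½aL⁻²⟨ψ − Q(u′)φ, ψ − Q(u′)φ⟩ − E^{(0)}]` (gen 6's consistency `rt51_single_ae_eq_rt` + §2).
NOT DONE HERE (honest scope).  Cut-offs / large-field regions ((5.3.6) with `Λ₁^{(k)′*c} ≠ ∅`); the rewriting of `∫𝒟u δ_{Ax}(u) (…)(u′(u))` as an
integral against *"δ(Qu′)δ_{Ax}(u′)𝒟u′"* in the variables `A′` ((3.12)–(3.15), (5.3.6)–(5.3.7): constraint sets and the Jacobian `e_k/2π` are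
p31's `BIJ88Eq536Linearization`/`BIJ88Eq537Jacobian`); the later translations (3.27)/(3.30), (5.3.2)–(5.3.5) (r18, r16, p02, p31 files); bounds.
Imports gen 7's `BIJ88Eq531TranslLaw` and gen 6's `BIJ88RT51Invariant` (Literature + Mathlib only); re-declares nothing.
-/

namespace Literature.MathematicalPhysics.QuantumFieldTheory.BalabanImbrieJaffe1984to88.BIJ88Eq531TranslDensity

open Literature.MathematicalPhysics.QuantumFieldTheory.Balaban1983to89
open BIJ88Sect3Statements (U1)
open BIJ85Sect1Model (HiggsField)
open BIJ85RT33 (JointInvariant)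
open BIJ88RenormTransf311 (axialMeasure gaussWeight)
open BIJ85BlockAveragesTorus (qU qCov surfMul uPrime measurable_qU map_surfMul_fieldMeasure map_qU_eq_of_invariant qCov_surfMul
  measurable_qCov absolutelyContinuous_map_qU torusRTData)
open BIJ88InductiveForm41 (Prev prevMeasure)
open BIJ88RT311Exists (gaussApprox axialMeasure_eq_map_ax)
open BIJ88RT51Density (rnC integrable_rnC integral_rnC_mul smear51 integrable_smear51)
open BIJ88RT51Unique (ae_eq_of_forall_test)
open BIJ88RT51Exists (rt51 uncurry_rt51)
open BIJ88RT51Invariant (rt51_single_ae_eq_rt)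
open BIJ88Eq531TranslLaw (qU_surfMul_uPrime measurable_uPrime measurable_surfMul₂ measurePreserving_transl axialMeasure_map_surfMul)
open scoped BigOperators ENNReal
open _root_.MeasureTheory _root_.MeasureTheory.Measure Function

noncomputable section

variable {P : Params} {j : ℕ}

/-! ## §1 The Radon–Nikodym density of `∫ν(du) δ(v/Qu)(…)` after the translation -/

section Density

variable {ν : Measure (GaugeField P j U1)} [IsProbabilityMeasure ν]

/-- kernel: the translation with a spectator block scalar field, `((v, ψ), u) ↦ (u′(u)·Q^{s*}v, ψ)`, carries `(dv ⊗ dψ) ⊗ ν` onto `ν ⊗ dψ`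
(gen 7's `measurePreserving_transl` × `id`, after the obvious reshuffling of factors). [cite: BalabanImbrieJaffe1988, (5.3.1) p.280] -/
theorem measurePreserving_transl₃ (hj : j + 1 ≤ P.m + P.K) (hν : ∀ w, ν.map (fun U => surfMul U w) = ν) :
    MeasurePreserving (fun r : (GaugeField P (j+1) U1 × HiggsField P (j+1)) × GaugeField P j U1 =>
        (surfMul (uPrime r.2) r.1.1, r.1.2))
      (((fieldMeasure P (j+1) U1).prod (volume : Measure (HiggsField P (j+1)))).prod ν)
      (ν.prod (volume : Measure (HiggsField P (j+1)))) := by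
  have s1 : MeasurePreserving (Prod.swap : (GaugeField P (j+1) U1 × HiggsField P (j+1)) × GaugeField P j U1 →
      GaugeField P j U1 × (GaugeField P (j+1) U1 × HiggsField P (j+1)))
      (((fieldMeasure P (j+1) U1).prod (volume : Measure (HiggsField P (j+1)))).prod ν)
      (ν.prod ((fieldMeasure P (j+1) U1).prod (volume : Measure (HiggsField P (j+1))))) :=
    measurePreserving_swap
  have s2 : MeasurePreserving (MeasurableEquiv.prodAssoc.symm : GaugeField P j U1 × (GaugeField P (j+1) U1 × HiggsField P (j+1)) →
      (GaugeField P j U1 × GaugeField P (j+1) U1) × HiggsField P (j+1))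
      (ν.prod ((fieldMeasure P (j+1) U1).prod (volume : Measure (HiggsField P (j+1)))))
      ((ν.prod (fieldMeasure P (j+1) U1)).prod (volume : Measure (HiggsField P (j+1)))) :=
    MeasurePreserving.symm MeasurableEquiv.prodAssoc
      (measurePreserving_prodAssoc ν (fieldMeasure P (j+1) U1) (volume : Measure (HiggsField P (j+1))))
  have s3 : MeasurePreserving
      (Prod.map (fun p : GaugeField P j U1 × GaugeField P (j+1) U1 => surfMul (uPrime p.1) p.2) (id : HiggsField P (j+1) → _))
      ((ν.prod (fieldMeasure P (j+1) U1)).prod (volume : Measure (HiggsField P (j+1))))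
      (ν.prod (volume : Measure (HiggsField P (j+1)))) :=
    (measurePreserving_transl hj hν).prod (MeasurePreserving.id _)
  have e : (fun r : (GaugeField P (j+1) U1 × HiggsField P (j+1)) × GaugeField P j U1 => (surfMul (uPrime r.2) r.1.1, r.1.2)) =
      (Prod.map (fun p : GaugeField P j U1 × GaugeField P (j+1) U1 => surfMul (uPrime p.1) p.2) (id : HiggsField P (j+1) → _)) ∘
        (MeasurableEquiv.prodAssoc.symm : GaugeField P j U1 × (GaugeField P (j+1) U1 × HiggsField P (j+1)) →
          (GaugeField P j U1 × GaugeField P (j+1) U1) × HiggsField P (j+1)) ∘ Prod.swap := by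
    funext r
    rfl
  rw [e]
  exact s3.comp (s2.comp s1)

/-- **THE RADON–NIKODYM DENSITY OF `∫ν(du) δ(v/Qu) G(u, ψ)` AFTER THE TRANSLATION (3.24)/(5.3.1)**: for a probability law `ν` of `u` invariant
under the substitutions `u ↦ u·Q^{s*}w` and a `ν ⊗ dψ`-integrable `G`, gen 6's complex density `rnC ν Q G` of `(Q × id)_*(G·(ν ⊗ dψ))` w.r.t.
`dv dψ` IS, `dv dψ`-a.e., the fibre integral `(v, ψ) ↦ ∫ν(du) G(u′(u)·Q^{s*}v, ψ)` — both integrate every bounded measurable test function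
`g(v, ψ)` to `∫ν∫dψ G(u, ψ) g(Qu, ψ)` (gen 6's `integral_rnC_mul`; the measure-preserving translation and `Q(u′·Q^{s*}v) = v`), and such a
density is unique up to null sets (gen 5's `ae_eq_of_forall_test`).  *"it removes the v-field from the δ-functions"* (p. 280). [cite: BalabanImbrieJaffe1988, (5.3.1) p.280] -/
theorem rnC_ae_eq_transl (hj : j + 1 ≤ P.m + P.K) (hν : ∀ w, ν.map (fun U => surfMul U w) = ν)
    {G : GaugeField P j U1 × HiggsField P (j+1) → ℂ} (hGi : Integrable G (ν.prod volume)) :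
    uncurry (rnC ν qU G) =ᵐ[(fieldMeasure P (j+1) U1).prod volume]
      uncurry (fun v ψ => ∫ U, G (surfMul (uPrime U) v, ψ) ∂ν) := by
  have hac : ν.map qU ≪ fieldMeasure P (j+1) U1 := Measure.absolutelyContinuous_of_eq (map_qU_eq_of_invariant hj ν hν)
  have hΘ := measurePreserving_transl₃ hj hν
  have hK : Integrable (fun r : (GaugeField P (j+1) U1 × HiggsField P (j+1)) × GaugeField P j U1 =>
      G (surfMul (uPrime r.2) r.1.1, r.1.2)) (((fieldMeasure P (j+1) U1).prod volume).prod ν) :=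
    (hΘ.integrable_comp hGi.aestronglyMeasurable).2 hGi
  refine ae_eq_of_forall_test (integrable_rnC hGi) hK.integral_prod_left fun g hg hgC => ?_
  obtain ⟨C, hC⟩ := hgC
  have hgQ : Measurable fun p : GaugeField P j U1 × HiggsField P (j+1) => g (qU p.1, p.2) :=
    hg.comp ((measurable_qU.comp measurable_fst).prodMk measurable_snd)
  have I1 : Integrable (fun q => uncurry (rnC ν qU G) q * g q) ((fieldMeasure P (j+1) U1).prod volume) :=
    (integrable_rnC hGi).mul_bdd hg.aestronglyMeasurable (Filter.Eventually.of_forall hC)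
  have I2 : Integrable (fun p : GaugeField P j U1 × HiggsField P (j+1) => G p * g (qU p.1, p.2)) (ν.prod volume) :=
    hGi.mul_bdd hgQ.aestronglyMeasurable (Filter.Eventually.of_forall fun p => hC _)
  have I3 : Integrable (fun r : (GaugeField P (j+1) U1 × HiggsField P (j+1)) × GaugeField P j U1 =>
      G (surfMul (uPrime r.2) r.1.1, r.1.2) * g (r.1.1, r.1.2)) (((fieldMeasure P (j+1) U1).prod volume).prod ν) :=
    hK.mul_bdd ((hg.comp measurable_fst).aestronglyMeasurable) (Filter.Eventually.of_forall fun r => hC _)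
  -- the δ-function side
  have lhs : ∫ v, ∫ ψ, rnC ν qU G v ψ * g (v, ψ) ∂volume ∂fieldMeasure P (j+1) U1 =
      ∫ p, G p * g (qU p.1, p.2) ∂ν.prod volume := by
    rw [← integral_rnC_mul measurable_qU hac hGi hg hC, integral_prod _ I1]
    rfl
  -- the translated side
  have rhs : ∫ p, G p * g (qU p.1, p.2) ∂ν.prod volume =
      ∫ q, ∫ U, G (surfMul (uPrime U) q.1, q.2) * g (q.1, q.2) ∂ν ∂(fieldMeasure P (j+1) U1).prod volume := by
    have hm : AEStronglyMeasurable (fun p : GaugeField P j U1 × HiggsField P (j+1) => G p * g (qU p.1, p.2))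
        (Measure.map (fun r : (GaugeField P (j+1) U1 × HiggsField P (j+1)) × GaugeField P j U1 =>
          (surfMul (uPrime r.2) r.1.1, r.1.2)) (((fieldMeasure P (j+1) U1).prod volume).prod ν)) := by
      rw [hΘ.map_eq]
      exact I2.aestronglyMeasurable
    rw [← hΘ.map_eq, integral_map hΘ.measurable.aemeasurable hm, ← integral_prod _ I3]
    refine integral_congr_ae (ae_of_all _ fun r => ?_)
    show G (surfMul (uPrime r.2) r.1.1, r.1.2) * g (qU (surfMul (uPrime r.2) r.1.1), r.1.2) = _
    rw [qU_surfMul_uPrime hj]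
  rw [lhs, rhs, integral_prod _ I3.integral_prod_left]
  refine integral_congr_ae (ae_of_all _ fun v => integral_congr_ae (ae_of_all _ fun ψ => ?_))
  exact integral_mul_const (g (v, ψ)) _

end Density


/-! ## §2 The densities of (5.1.1)/(3.11) after the translation -/

section RT

variable {k : ℕ} {ν : Measure (GaugeField P k U1)} [IsProbabilityMeasure ν]
variable {ι : Type*} {terms : Finset ι}
variable {Qφ : ι → Prev P k → GaugeField P k U1 → HiggsField P k → HiggsField P (k+1)} {a : ℝ}
variable {ρ' : ι → Prev P k → GaugeField P k U1 → HiggsField P k → ℂ}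

/-- **THE (5.1.1) DENSITY AFTER THE TRANSLATION**: for a substitution-invariant probability law `ν` (`𝒟u`, `𝒟u δ_{Ax}(u)`), a finite family of
terms with measurable background kernels `Q_t` and measurable, `ν ⊗ Π𝒟u^{(j)} ⊗ 𝒟φ`-integrable `ρ′_t` (`a > 0`, `d ≥ 2`, standing range), gen 6's
constructed `ρ̃^L_{k+1} = rt51 ν {X_ω} Q Q_t a ρ′` equals `dv dψ`-a.e. `(v, ψ) ↦ Σ_t ∫ν(du) G_t(u′(u)·Q^{s*}v, ψ)` with `G_t = smear51 Q_t a ρ′_t`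
(`rnC_ae_eq_transl` term by term, gen 6's `integrable_smear51`). [cite: BalabanImbrieJaffe1988, (5.1.1) p.277] -/
theorem rt51_ae_eq_transl (hk : k + 1 ≤ P.m + P.K) (hν : ∀ w, ν.map (fun U => surfMul U w) = ν) (ha : 0 < a) (hd : 2 ≤ P.d)
    (hQφ : ∀ t ∈ terms, Measurable fun p : Prev P k × (GaugeField P k U1 × HiggsField P k) => Qφ t p.1 p.2.1 p.2.2)
    (hρm : ∀ t ∈ terms, Measurable fun p : Prev P k × (GaugeField P k U1 × HiggsField P k) => ρ' t p.1 p.2.1 p.2.2)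
    (hρi : ∀ t ∈ terms, Integrable (fun q : GaugeField P k U1 × (Prev P k × HiggsField P k) => ρ' t q.2.1 q.1 q.2.2)
      (ν.prod ((prevMeasure P k).prod volume))) :
    uncurry (rt51 ν terms qU Qφ a ρ') =ᵐ[(fieldMeasure P (k+1) U1).prod volume]
      uncurry (fun v ψ => ∑ t ∈ terms, ∫ U, smear51 (Qφ t) a (ρ' t) (surfMul (uPrime U) v, ψ) ∂ν) := by
  have h : ∀ t ∈ terms, uncurry (rnC ν qU (smear51 (Qφ t) a (ρ' t))) =ᵐ[(fieldMeasure P (k+1) U1).prod volume]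
      uncurry (fun v ψ => ∫ U, smear51 (Qφ t) a (ρ' t) (surfMul (uPrime U) v, ψ) ∂ν) := fun t ht =>
    rnC_ae_eq_transl hk hν (integrable_smear51 ha hd (hQφ t ht) (hρm t ht) (hρi t ht))
  have h' : ∀ᵐ q ∂(fieldMeasure P (k+1) U1).prod volume, ∀ t ∈ terms, uncurry (rnC ν qU (smear51 (Qφ t) a (ρ' t))) q =
      uncurry (fun v ψ => ∫ U, smear51 (Qφ t) a (ρ' t) (surfMul (uPrime U) v, ψ) ∂ν) q :=
    (Filter.eventually_all_finset terms).2 h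
  filter_upwards [h'] with q hq
  rw [uncurry_rt51]
  exact Finset.sum_congr rfl hq

/-- **the printed scalar kernel does not see the substituted block field**: for a history-free term with `Q_t = Q(·)φ` of [2] (2.6) (r18's
`qCov`), the smeared density at the translated field is `∫𝒟φ ρ₀(u′·Q^{s*}v, φ)·gaussWeight a (Q(u′)φ) ψ` — `Q(u′·Q^{s*}v)φ = Q(u′)φ` (r18's
`qCov_surfMul`: the average (2.6) transports along contours inside blocks, which contain no surface bond), the `Π𝒟u^{(j)}`-integral of a
constant being the constant. [cite: BalabanImbrieJaffe1988, (5.3.1) p.280] -/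
theorem smear51_qCov_transl (hk : k + 1 ≤ P.m + P.K) (ρ₀ : GaugeField P k U1 → HiggsField P k → ℂ) (a : ℝ)
    (U : GaugeField P k U1) (v : GaugeField P (k+1) U1) (ψ : HiggsField P (k+1)) :
    smear51 (fun (_ : Prev P k) => qCov) a (fun _ => ρ₀) (surfMul (uPrime U) v, ψ) =
      ∫ φ, ρ₀ (surfMul (uPrime U) v) φ * (gaussWeight a (qCov (uPrime U) φ) ψ : ℂ) := by
  show ∫ _prev, ∫ φ, ρ₀ (surfMul (uPrime U) v) φ * (gaussWeight a (qCov (surfMul (uPrime U) v) φ) ψ : ℂ) ∂volume ∂prevMeasure P k = _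
  rw [BIJ88InductiveForm41.integral_rhoPrime_const]
  simp only [qCov_surfMul hk]

/-- **THE PRINTED-KERNEL DENSITY AFTER THE TRANSLATION**: for one history-free term with `Qu` = (2.10) and `Q(u)φ` = (2.6) of [2] (the printed
(3.11), and (5.1.1) at its first-step shape), `ρ₀` jointly measurable and `ν ⊗ 𝒟φ`-integrable, `ν` substitution invariant (`a > 0`, `d ≥ 2`,
standing range): `rt51 ν {•} Q Q(·)φ a ρ₀ =ᵐ[dv dψ] (v, ψ) ↦ ∫ν(du) ∫𝒟φ ρ₀(u′(u)·Q^{s*}v, φ) exp[−½aL⁻²⟨ψ − Q(u′)φ, ψ − Q(u′)φ⟩ − E]` — after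
(3.24)/(5.3.1) the block gauge field `v` is out of the δ-function AND out of the `ψ`-Gaussian. [cite: BalabanImbrieJaffe1988, (3.24) p.269] -/
theorem rt51_printed_ae_eq_transl (hk : k + 1 ≤ P.m + P.K) (hν : ∀ w, ν.map (fun U => surfMul U w) = ν) (ha : 0 < a)
    (hd : 2 ≤ P.d) {ρ₀ : GaugeField P k U1 → HiggsField P k → ℂ} (hρm : Measurable (uncurry ρ₀))
    (hρi : Integrable (uncurry ρ₀) (ν.prod volume)) :
    uncurry (rt51 ν (Finset.univ : Finset Unit) qU (fun _ _ => qCov) a (fun _ _ => ρ₀)) =ᵐ[(fieldMeasure P (k+1) U1).prod volume]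
      uncurry (fun v ψ => ∫ U, ∫ φ, ρ₀ (surfMul (uPrime U) v) φ * (gaussWeight a (qCov (uPrime U) φ) ψ : ℂ) ∂volume ∂ν) := by
  have hσ : MeasurePreserving (Prod.map id Prod.snd : GaugeField P k U1 × (Prev P k × HiggsField P k) → GaugeField P k U1 × HiggsField P k)
      (ν.prod ((prevMeasure P k).prod volume)) (ν.prod volume) :=
    (MeasurePreserving.id _).prod measurePreserving_snd
  have hρi' : Integrable (fun q : GaugeField P k U1 × (Prev P k × HiggsField P k) => ρ₀ q.1 q.2.2)
      (ν.prod ((prevMeasure P k).prod volume)) :=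
    (hσ.integrable_comp hρi.aestronglyMeasurable).2 hρi
  have h := rt51_ae_eq_transl (terms := (Finset.univ : Finset Unit)) (Qφ := fun (_ : Unit) (_ : Prev P k) => qCov)
    (ρ' := fun (_ : Unit) (_ : Prev P k) => ρ₀) hk hν ha hd (fun _ _ => measurable_qCov.comp measurable_snd)
    (fun _ _ => hρm.comp measurable_snd) (fun _ _ => hρi')
  refine h.trans (ae_of_all _ fun q => ?_)
  simp only [uncurry, Finset.univ_unique, Finset.sum_singleton]
  refine integral_congr_ae (ae_of_all _ fun U => ?_)
  exact smear51_qCov_transl hk ρ₀ a U q.1 q.2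

/-- instance `ν = 𝒟u δ_{Ax}(u)` (the measure of (3.11), and of (5.1.1) with (5.1.4) inserted): the printed-kernel density after the translation,
`ρ₀` jointly measurable and `𝒟u δ_{Ax}𝒟φ`-integrable. [cite: BalabanImbrieJaffe1988, (5.3.1) p.280] -/
theorem rt51_printed_axialMeasure_ae_eq_transl (hk : k + 1 ≤ P.m + P.K) (ha : 0 < a) (hd : 2 ≤ P.d)
    {ρ₀ : GaugeField P k U1 → HiggsField P k → ℂ} (hρm : Measurable (uncurry ρ₀))
    (hρi : Integrable (uncurry ρ₀) ((axialMeasure P k U1).prod volume)) :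
    uncurry (rt51 (axialMeasure P k U1) (Finset.univ : Finset Unit) qU (fun _ _ => qCov) a (fun _ _ => ρ₀))
      =ᵐ[(fieldMeasure P (k+1) U1).prod volume]
      uncurry (fun v ψ => ∫ U, ∫ φ, ρ₀ (surfMul (uPrime U) v) φ * (gaussWeight a (qCov (uPrime U) φ) ψ : ℂ) ∂volume ∂axialMeasure P k U1) :=
  rt51_printed_ae_eq_transl hk axialMeasure_map_surfMul ha hd hρm hρi

/-- instance `ν = 𝒟u` (the printed (5.1.1) before (5.1.4)): the printed-kernel density after the translation, `ρ₀` jointly measurable and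
`𝒟u𝒟φ`-integrable. [cite: BalabanImbrieJaffe1988, (5.3.1) p.280] -/
theorem rt51_printed_fieldMeasure_ae_eq_transl (hk : k + 1 ≤ P.m + P.K) (ha : 0 < a) (hd : 2 ≤ P.d)
    {ρ₀ : GaugeField P k U1 → HiggsField P k → ℂ} (hρm : Measurable (uncurry ρ₀))
    (hρi : Integrable (uncurry ρ₀) ((fieldMeasure P k U1).prod volume)) :
    uncurry (rt51 (fieldMeasure P k U1) (Finset.univ : Finset Unit) qU (fun _ _ => qCov) a (fun _ _ => ρ₀))
      =ᵐ[(fieldMeasure P (k+1) U1).prod volume]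
      uncurry (fun v ψ => ∫ U, ∫ φ, ρ₀ (surfMul (uPrime U) v) φ * (gaussWeight a (qCov (uPrime U) φ) ψ : ℂ) ∂volume ∂fieldMeasure P k U1) :=
  rt51_printed_ae_eq_transl hk map_surfMul_fieldMeasure ha hd hρm hρi

end RT

/-! ## §3 The printed (3.11) density of the model (r18's `torusRTData`) after the translation -/

section Model

variable {k : ℕ} {a : ℝ}

/-- **A jointly gauge-invariant `𝒟u𝒟φ`-integrable density is `𝒟u δ_{Ax}(u)𝒟φ`-integrable** (same `L¹` norm): `𝒟u δ_{Ax}(u)` is the image of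
`𝒟u` under the axial gauge fixing `u ↦ u[T := 1]` (gen 2's `axialMeasure_eq_map_ax` for r18's datum `torusRTData`) and [2] (3.7)
(`BIJ85RT37Normalization.integrable_comp_ax`). [cite: BalabanImbrieJaffe1988, (3.11) p.266] -/
theorem integrable_axialMeasure_of_jointInvariant (hk : k + 1 ≤ P.m + P.K) {ρ₀ : GaugeField P k U1 → HiggsField P k → ℂ}
    (hρm : Measurable (uncurry ρ₀)) (hρg : JointInvariant ρ₀) (hρi : Integrable (uncurry ρ₀) ((fieldMeasure P k U1).prod volume)) :
    Integrable (uncurry ρ₀) ((axialMeasure P k U1).prod volume) := by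
  have hax : axialMeasure P k U1 = (fieldMeasure P k U1).map (torusRTData hk).ax :=
    axialMeasure_eq_map_ax (D := torusRTData hk) rfl
  have hπ : MeasurePreserving (Prod.map (torusRTData hk).ax id : GaugeField P k U1 × HiggsField P k → GaugeField P k U1 × HiggsField P k)
      ((fieldMeasure P k U1).prod volume) (((fieldMeasure P k U1).map (torusRTData hk).ax).prod volume) :=
    (⟨(torusRTData hk).measurable_ax, rfl⟩ : MeasurePreserving (torusRTData hk).ax (fieldMeasure P k U1)
      ((fieldMeasure P k U1).map (torusRTData hk).ax)).prod (MeasurePreserving.id _)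
  rw [hax]
  exact (hπ.integrable_comp hρm.aestronglyMeasurable).1 (BIJ85RT37Normalization.integrable_comp_ax (D := torusRTData hk) hρm hρg hρi)

/-- **THE MODEL'S (3.11) DENSITY AFTER THE TRANSLATION (3.24).**  For `a > 0`, `d ≥ 2` (standing range) and every density `ρ₀(u, φ)` that is
jointly measurable, jointly gauge invariant and `𝒟u𝒟φ`-integrable, r18's hypothesis-free solution `ρ₁^L = 𝒯ρ₀ = (torusRTData).rt (gaussApprox) ρ₀`
of the printed (3.11) (block averages (2.6)/(2.10) of [2], axial gauge (3.4)) satisfies, `dv dψ`-almost everywhere,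
`ρ₁^L(v, ψ) = ∫𝒟u δ_{Ax}(u) ∫𝒟φ ρ₀(u′(u)·Q^{s*}v, φ) exp[−½aL⁻²⟨ψ − Q(u′)φ, ψ − Q(u′)φ⟩ − E^{(0)}]` — the `δ(v/Qu)` of (3.11) is gone and `v`
enters through the translated gauge field only (gen 6's consistency `rt51_single_ae_eq_rt` + `rt51_printed_ae_eq_transl` under `𝒟u δ_{Ax}`).
[cite: BalabanImbrieJaffe1988, (3.24) p.269] -/
theorem rt_torusRTData_ae_eq_transl (hk : k + 1 ≤ P.m + P.K) (ha : 0 < a) (hd : 2 ≤ P.d)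
    {ρ₀ : GaugeField P k U1 → HiggsField P k → ℂ} (hρm : Measurable (uncurry ρ₀)) (hρg : JointInvariant ρ₀)
    (hρi : Integrable (uncurry ρ₀) ((fieldMeasure P k U1).prod volume)) :
    uncurry ((torusRTData hk).rt (gaussApprox ha hd) ρ₀) =ᵐ[(fieldMeasure P (k+1) U1).prod volume]
      uncurry (fun v ψ => ∫ U, ∫ φ, ρ₀ (surfMul (uPrime U) v) φ * (gaussWeight a (qCov (uPrime U) φ) ψ : ℂ) ∂volume ∂axialMeasure P k U1) := by
  have hρa := integrable_axialMeasure_of_jointInvariant hk hρm hρg hρi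
  exact (rt51_single_ae_eq_rt hk ha hd measurable_qU (absolutelyContinuous_map_qU hk) measurable_qCov hρm hρa).symm.trans
    (rt51_printed_ae_eq_transl hk axialMeasure_map_surfMul ha hd hρm hρa)

end Model

end

end Literature.MathematicalPhysics.QuantumFieldTheory.BalabanImbrieJaffe1984to88.BIJ88Eq531TranslDensity
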